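import Summits.Schanuel.Schanuel.Theorems.RootDecomp1KKummerDegree

/-!
# RootDecomp1KKummerFactors — §22 REV D «KummerCells» port, part 2/4 (lens 6, gen 10 = ROUND 5 theorem round of route-Schanuel-RootDecomp1K on A₄ʰ stmt-Schanuel-33363)

Mechanical port (census-1 gen 8; tools tools/build_dark.py over census/tools/gen7/portkit2.py) of §22 of HOME/decomp-schanuel-lens-6/g10/addendum/KummerCells.lean
(sha256 228dad56…, 9085 l; critic VERDICT 2026-08-30T17:19:03Z ACCEPTED — THEOREM ROUND, PATH T, census C-7) on top of the §17 wave Theorems/RootDecomp1KHyper01…19.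
This part: node lines 8409–8577 (12 declarations: exponent_le_kummer, endgame_kummer, norm_multiset_map_prod_le, multiset_map_prod_le, conjFactor_torG_ne_zero_kummer, kumF …).
The node-local named fact `NWThm1` is replaced by the registered Literature fact
`Literature.NumberTheory.Transcendental.NesterenkoWaldschmidt1996_thm_1` (token-identical body); statements and proofs
are otherwise the node's verbatim, in the wave namespace `Summit.Schanuel.Schanuel.Theorems.RootDecomp1KHyper` (sub-namespace `HyperCell`).
`--supports stmt-Schanuel-33363` (A₄ʰ HyperLiouvilleSchanuel: decided n = 2, 3 cells at every Kummer anchor s·log 2, s ∈ ℚ^× (ρ hyper-Liouville), mod the registered fact NW96 Thm 1 alone). Sorry-free; standard axioms. Nothing here proves Schanuel; rung 0.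
-/

set_option linter.dupNamespace false
set_option linter.unusedSectionVars false

noncomputable section

open Complex IntermediateField Filter Polynomial

namespace Summit.Schanuel.Schanuel.Theorems.RootDecomp1KHyper

variable {n K : ℕ}

namespace HyperCell

variable {n K : ℕ}

section LogTwo

open Literature.NumberTheory.Transcendental in
/-- §22k. endgame arithmetic (degree 6): auxiliary statement `exponent_le_kummer` (lens 6 gen 10 node, ported verbatim). -/
theorem exponent_le_kummer {Q K d LΛ A₂ : ℝ} (hQ1 : 1 ≤ Q) (hK0 : 0 ≤ K) (hd1 : 1 ≤ d)
    (hdQ : d ≤ (K + 1) * Q) (hA₂ : 0 ≤ A₂) (hLΛ0 : 0 ≤ LΛ) (hLΛ : LΛ ≤ A₂ * Q ^ 2) :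
    d * (211 * (LΛ + 5 * d + 13) * (2 * d + 10) * (4 * d ^ 2 + 7 * d + 1) + (LΛ + d + 1)) ≤
      ((K + 1) * (211 * (A₂ + 5 * (K + 1) + 13) * (2 * (K + 1) + 10) *
        (4 * (K + 1) ^ 2 + 7 * (K + 1) + 1) + (A₂ + (K + 1) + 1))) * Q ^ 6 := by
  set k := K + 1 with hk
  have hk1 : 1 ≤ k := by linarith
  have hQ2 : Q ≤ Q ^ 2 := by nlinarith
  have h1Q2 : 1 ≤ Q ^ 2 := by nlinarith
  have hQ25 : Q ^ 2 ≤ Q ^ 5 := pow_le_pow_right₀ hQ1 (by norm_num)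
  have hd0 : 0 ≤ d := by linarith
  -- factor bounds
  have b1 : LΛ + 5 * d + 13 ≤ (A₂ + 5 * k + 13) * Q ^ 2 := by
    have : d ≤ k * Q ^ 2 := hdQ.trans (mul_le_mul_of_nonneg_left hQ2 (by linarith))
    nlinarith
  have b2 : 2 * d + 10 ≤ (2 * k + 10) * Q := by nlinarith
  have b3 : 4 * d ^ 2 + 7 * d + 1 ≤ (4 * k ^ 2 + 7 * k + 1) * Q ^ 2 := by
    have : d ^ 2 ≤ (k * Q) ^ 2 := by rw [sq, sq]; exact mul_le_mul hdQ hdQ hd0 (by positivity)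
    have : d ≤ k * Q ^ 2 := hdQ.trans (mul_le_mul_of_nonneg_left hQ2 (by linarith))
    nlinarith
  have b4 : LΛ + d + 1 ≤ (A₂ + k + 1) * Q ^ 2 := by
    have : d ≤ k * Q ^ 2 := hdQ.trans (mul_le_mul_of_nonneg_left hQ2 (by linarith))
    nlinarith
  have p1 : 0 ≤ LΛ + 5 * d + 13 := by positivity
  have p2 : 0 ≤ 2 * d + 10 := by positivity
  have p3 : 0 ≤ 4 * d ^ 2 + 7 * d + 1 := by positivity
  have hprod : 211 * (LΛ + 5 * d + 13) * (2 * d + 10) * (4 * d ^ 2 + 7 * d + 1) ≤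
      211 * ((A₂ + 5 * k + 13) * Q ^ 2) * ((2 * k + 10) * Q) * ((4 * k ^ 2 + 7 * k + 1) * Q ^ 2) := by
    gcongr
  have e1 : 211 * ((A₂ + 5 * k + 13) * Q ^ 2) * ((2 * k + 10) * Q) * ((4 * k ^ 2 + 7 * k + 1) * Q ^ 2) =
      (211 * (A₂ + 5 * k + 13) * (2 * k + 10) * (4 * k ^ 2 + 7 * k + 1)) * Q ^ 5 := by ring
  rw [e1] at hprod
  have c0 : 0 ≤ 211 * (A₂ + 5 * k + 13) * (2 * k + 10) * (4 * k ^ 2 + 7 * k + 1) := by positivity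
  have b4' : LΛ + d + 1 ≤ (A₂ + k + 1) * Q ^ 5 :=
    b4.trans (mul_le_mul_of_nonneg_left hQ25 (by positivity))
  have hsum : 211 * (LΛ + 5 * d + 13) * (2 * d + 10) * (4 * d ^ 2 + 7 * d + 1) + (LΛ + d + 1) ≤
      (211 * (A₂ + 5 * k + 13) * (2 * k + 10) * (4 * k ^ 2 + 7 * k + 1) + (A₂ + k + 1)) * Q ^ 5 := by
    linarith
  have hsum0 : 0 ≤ 211 * (LΛ + 5 * d + 13) * (2 * d + 10) * (4 * d ^ 2 + 7 * d + 1) + (LΛ + d + 1) := by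
    positivity
  calc d * (211 * (LΛ + 5 * d + 13) * (2 * d + 10) * (4 * d ^ 2 + 7 * d + 1) + (LΛ + d + 1))
      ≤ (k * Q) * ((211 * (A₂ + 5 * k + 13) * (2 * k + 10) * (4 * k ^ 2 + 7 * k + 1) +
          (A₂ + k + 1)) * Q ^ 5) := mul_le_mul hdQ hsum hsum0 (by positivity)
    _ = (k * (211 * (A₂ + 5 * k + 13) * (2 * k + 10) * (4 * k ^ 2 + 7 * k + 1) +
          (A₂ + k + 1))) * Q ^ 6 := by ring

open Literature.NumberTheory.Transcendental in
/-- §22k. endgame arithmetic (degree 6): auxiliary statement `endgame_kummer` (lens 6 gen 10 node, ported verbatim). -/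
theorem endgame_kummer {Q A₁ A₃ : ℝ} (hQ1 : 1 ≤ Q) (hA₁ : 0 ≤ A₁) (_hA₃ : 0 ≤ A₃)
    (hQA : A₁ + A₃ + 1 ≤ Q) (h : -(A₃ * Q ^ 6) < A₁ * Q ^ 2 + -(Q ^ 7)) : False := by
  have hQ0 : 0 < Q := by linarith
  have hQ2 : Q ^ 2 ≤ Q ^ 6 := pow_le_pow_right₀ hQ1 (by norm_num)
  have hQ6 : 0 < Q ^ 6 := by positivity
  have h1 : Q ^ 7 < (A₁ + A₃) * Q ^ 6 := by
    have := mul_le_mul_of_nonneg_left hQ2 hA₁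
    linarith
  have h2 : (A₁ + A₃) * Q ^ 6 < Q * Q ^ 6 := by
    apply mul_lt_mul_of_pos_right _ hQ6; linarith
  have h3 : Q * Q ^ 6 = Q ^ 7 := by ring
  linarith

end LogTwo

/-- §22g. Multiset product bounds: auxiliary statement `norm_multiset_map_prod_le` (lens 6 gen 10 node, ported verbatim). -/
theorem norm_multiset_map_prod_le {ι : Type*} (φ : ι → ℂ) {M : ℝ} (hM : 0 ≤ M) :
    ∀ s : Multiset ι, (∀ x ∈ s, ‖φ x‖ ≤ M) → ‖(s.map φ).prod‖ ≤ M ^ Multiset.card s := by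
  intro s
  induction s using Multiset.induction_on with
  | empty => intro _; simp
  | cons a s ih =>
    intro h
    rw [Multiset.map_cons, Multiset.prod_cons, norm_mul, Multiset.card_cons, pow_succ, mul_comm (M ^ _)]
    exact mul_le_mul (h a (Multiset.mem_cons_self a s))
      (ih fun x hx => h x (Multiset.mem_cons_of_mem hx)) (norm_nonneg _) hM

/-- §22g. Multiset product bounds: auxiliary statement `multiset_map_prod_le` (lens 6 gen 10 node, ported verbatim). -/
theorem multiset_map_prod_le {ι : Type*} (g : ι → ℝ) {M : ℝ} :
    ∀ s : Multiset ι, (∀ x ∈ s, 0 ≤ g x) → (∀ x ∈ s, g x ≤ M) →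
      (s.map g).prod ≤ M ^ Multiset.card s := by
  intro s
  induction s using Multiset.induction_on with
  | empty => intro _ _; simp
  | cons a s ih =>
    intro h0 h
    have hM : 0 ≤ M := (h0 a (Multiset.mem_cons_self a s)).trans (h a (Multiset.mem_cons_self a s))
    rw [Multiset.map_cons, Multiset.prod_cons, Multiset.card_cons, pow_succ, mul_comm (M ^ _)]
    refine mul_le_mul (h a (Multiset.mem_cons_self a s))
      (ih (fun x hx => h0 x (Multiset.mem_cons_of_mem hx)) fun x hx => h x (Multiset.mem_cons_of_mem hx))
      ?_ hM
    exact Multiset.prod_nonneg fun y hy => by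
      obtain ⟨x, hx, rfl⟩ := Multiset.mem_map.mp hy
      exact h0 x (Multiset.mem_cons_of_mem hx)

/-- §22h. Non-vanishing of the conjugate factors at the Kummer roots b, b^q = 2^p: auxiliary statement `conjFactor_torG_ne_zero_kummer` (lens 6 gen 10 node, ported verbatim). -/
theorem conjFactor_torG_ne_zero_kummer {P : MvPolynomial (Fin 3) ℤ} {D : ℕ} {p : ℤ} {q : ℕ}
    {K N : ℕ} (hD : ∀ s ∈ P.support, s 0 ≤ D)
    (hN : ∀ s ∈ P.support, s 2 ≤ N) {s₀ : Fin 3 →₀ ℕ} (hs₀ : s₀ ∈ P.support) (hs₀K : s₀ 1 ≤ K)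
    (r : ℚ) (hp : p = r.num) (hq : q = r.den)
    (hq1 : denBound (torD P (s₀ 1) (s₀ 2)) ≤ q) (hq2 : N < q) {pn : ℕ} (hcop : Nat.Coprime pn q)
    {b : ℂ} (hb : b ^ q = (2 : ℂ) ^ pn) : conjFactor (torG P D p q K) b ≠ 0 := by
  have hq0 : q ≠ 0 := by rw [hq]; exact r.den_nz
  intro h0
  set k : Fin (K + 1) := ⟨s₀ 1, Nat.lt_succ_of_le hs₀K⟩ with hk
  have hcoef : aeval b (torG P D p q K k) = 0 := by
    have := coeff_conjFactor (torG P D p q K) b k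
    rw [h0, coeff_zero] at this
    exact this.symm
  by_cases hG : torG P D p q K k = 0
  · have h1 := coeff_torG_eq_torD D p q hD hq0 k (s₀ 2)
    rw [hG, coeff_zero, Int.cast_zero, eq_comm, mul_eq_zero] at h1
    have hqQ : (q : ℚ) ^ D ≠ 0 := pow_ne_zero _ (by exact_mod_cast hq0)
    have h2 : aeval ((p : ℚ) / q) (torD P (s₀ 1) (s₀ 2)) = 0 := (or_iff_right hqQ).mp h1
    have hr : ((p : ℚ) / q) = r := by rw [hp, hq]; exact Rat.num_div_den r
    rw [hr] at h2
    have := den_lt_denBound (torD_ne_zero hs₀) h2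
    omega
  · have h2 := natDegree_torG_le P D p q K hN k
    exact kummer_aeval_ne_zero Nat.prime_two (Nat.pos_of_ne_zero hq0) hcop
      (b := b) (by exact_mod_cast hb) hG (lt_of_le_of_lt h2 hq2) hcoef

/-- §22i. The C¹ function x ↦ P(x, log 2, 2^x): auxiliary statement `kumF` (lens 6 gen 10 node, ported verbatim). -/
def kumF (P : MvPolynomial (Fin 3) ℤ) (x : ℝ) : ℂ :=
  ∑ s ∈ P.support, ((P.coeff s : ℤ) : ℂ) *
    ((x : ℂ) ^ (s 0) * ((Real.log 2 : ℝ) : ℂ) ^ (s 1) * cexp (((Real.log 2 : ℝ) : ℂ) * (x : ℂ)) ^ (s 2))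

/-- §22i. The C¹ function x ↦ P(x, log 2, 2^x): auxiliary statement `kumF_eq_aeval` (lens 6 gen 10 node, ported verbatim). -/
theorem kumF_eq_aeval (P : MvPolynomial (Fin 3) ℤ) (x : ℝ) :
    kumF P x = MvPolynomial.aeval
      ![(x : ℂ), ((Real.log 2 : ℝ) : ℂ), cexp (((Real.log 2 : ℝ) : ℂ) * (x : ℂ))] P := by
  unfold kumF
  rw [MvPolynomial.aeval_def, MvPolynomial.eval₂_eq']
  refine Finset.sum_congr rfl fun s _ => ?_
  rw [Fin.prod_univ_three]
  simp only [algebraMap_int_eq, eq_intCast, Matrix.cons_val_zero, Matrix.cons_val_one,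
    Matrix.cons_val]

/-- §22i. The C¹ function x ↦ P(x, log 2, 2^x): auxiliary statement `contDiff_kumF` (lens 6 gen 10 node, ported verbatim). -/
theorem contDiff_kumF (P : MvPolynomial (Fin 3) ℤ) : ContDiff ℝ 1 (kumF P) := by
  have hx : ContDiff ℝ 1 (fun x : ℝ => (x : ℂ)) := Complex.ofRealCLM.contDiff
  unfold kumF
  refine ContDiff.sum fun s _ => ?_
  refine contDiff_const.mul (((hx.pow _).mul contDiff_const).mul ?_)
  exact (Complex.contDiff_exp.comp (contDiff_const.mul hx)).pow _

/-- §22i. The C¹ function x ↦ P(x, log 2, 2^x): auxiliary statement `exists_lipschitz_kumF` (lens 6 gen 10 node, ported verbatim). -/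
theorem exists_lipschitz_kumF (P : MvPolynomial (Fin 3) ℤ) (ρ : ℝ) :
    ∃ Kl δ₁ : ℝ, 0 ≤ Kl ∧ 0 < δ₁ ∧
      ∀ x : ℝ, |x - ρ| < δ₁ → ‖kumF P x - kumF P ρ‖ ≤ Kl * |x - ρ| := by
  obtain ⟨K, t, ht, hK⟩ := ((contDiff_kumF P).contDiffAt (x := ρ)).exists_lipschitzOnWith
  obtain ⟨δ₁, hδ₁, hball⟩ := Metric.mem_nhds_iff.mp ht
  refine ⟨K, δ₁, K.2, hδ₁, fun x hx => ?_⟩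
  have hxt : x ∈ t := hball (by rw [Metric.mem_ball, Real.dist_eq]; exact hx)
  have hρt : ρ ∈ t := hball (Metric.mem_ball_self hδ₁)
  have := (lipschitzOnWith_iff_dist_le_mul.mp hK) x hxt ρ hρt
  rwa [dist_eq_norm, Real.dist_eq] at this

/-- §22j. Kummer data in ℂ: the polynomial X^q − 2^p: auxiliary statement `map_X_pow_sub_C_two_pow` (lens 6 gen 10 node, ported verbatim). -/
theorem map_X_pow_sub_C_two_pow (q pn : ℕ) :
    ((X ^ q - C ((2 : ℤ) ^ pn) : ℤ[X]).map (Int.castRingHom ℂ)) = X ^ q - C ((2 : ℂ) ^ pn) := by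
  rw [Polynomial.map_sub, Polynomial.map_pow, map_X, map_C, eq_intCast]
  push_cast
  rfl

/-- §22j. Kummer data in ℂ: the polynomial X^q − 2^p: auxiliary statement `cexp_log_two` (lens 6 gen 10 node, ported verbatim). -/
theorem cexp_log_two : cexp (((Real.log 2 : ℝ) : ℂ)) = 2 := by
  rw [← Complex.ofReal_exp, Real.exp_log (by norm_num : (0 : ℝ) < 2)]; norm_num

/-- §22j. Kummer data in ℂ: the polynomial X^q − 2^p: auxiliary statement `log_mul_extra_le` (lens 6 gen 10 node, ported verbatim). -/
theorem log_mul_extra_le {X W : ℝ} (hX : 0 ≤ X) (hW : 1 ≤ W) :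
    Real.log (X * W + 3) ≤ Real.log (X + 3) + Real.log W := by
  rw [← Real.log_mul (by linarith) (by linarith)]
  refine Real.log_le_log (by positivity) ?_
  nlinarith

end HyperCell

end Summit.Schanuel.Schanuel.Theorems.RootDecomp1KHyper
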